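import HarnessLib.Audit.LibrarySuggestionsDenyListCorCM
import Summits.HodgeConjecture.CorCM.HypLiu418.A3Liu418GSUntwisted
import Literature.AlgebraicGeometry.Motives.AbelianVarietyConjugateEtaleH1Transport
import Literature.NumberTheory.GaloisRepresentations.AbsGaloisConjByFrobeniusAt
import Literature.NumberTheory.Automorphic.GaloisActionPlaces
import Mathlib.FieldTheory.IsAlgClosed.Basic
import HarnessLib

/-!
# K2 — the c-TWIST TRANSPORT for the GS curve tower: `H¹_ét` of `X⋆_K = M⋆_K ⊗_{F,c} F` versus `H¹_ét` of `M⋆_K`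
# (arithmetic Frobenius at `v` on the twist = arithmetic Frobenius at `c v` on the model)

Cell `hodgecm-mathlib` (D-0151), fan A; Summits lane `CorCM/HypLiu418/`; namespace `Summit.HodgeConjecture.CorCM.Lines.A3Liu418`.
Seat A-p13 (g18), 2026-08-30, director s201 (3)(ii) «K2 transport lemma», consumer shape = A-p15 (g11) (K2a)(K2b)(K2c) for the d6 line.
Sequel of `A3Liu418GSUntwisted` (§1 `sec42DataGSM`, §1′ `etaleHeckeDatumGSM`, §2 `AlbConjDatum` ∕ `albConjDatum`).  DEFINITIONS WITH
BODIES and THEOREMS; no named fact, no instance, no `sorry`.  HC_CM is proved only modulo the 7 printed citations until rung 0 closes;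
nothing of [Liu2021] is asserted here.

* §3 from a datum `D : AlbConjDatum S h4 iso`: level isomorphisms `ψ_K : H¹_ét(Alb X⋆_K) ≃ H¹_ét(Alb M⋆_K)` (dual of `V_ℓ(e_K)` followed
  by the `c̃`-transport ★ `conjTransportEtaleH1Equiv`), `levelEquiv_dualMap_of_conj` (the level engine), compatibility with the transition
  maps, hence **(K2a) `towerEquiv D : H¹_ét(X⋆-tower) ≃ₗ[ℚ_ℓ] H¹_ét(M⋆-tower)`** (`Module.DirectLimit.congr`) with
  **(K2c-raw) `towerEquiv_towerRep : Ψ (towerRep_X σ y) = towerRep_M (c̃⁻¹σc̃) (Ψ y)`**.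
* §4 the PACKAGED (K2c) in `IsArithFrobAt` currency (★ `AbsGaloisConjByFrobeniusAt`): an arithmetic Frobenius at `𝔓 ∣ w` on the twist
  is carried to one at a prime above `c • w`.
* §5 **(K2b, HONEST) `towerEquiv_rhoEt_GSM`**: `Ψ` intertwines ★ `etaleHeckeDatumGS` (twist) with `etaleHeckeDatumGSM` (`M⋆`'s own),
  via ★ `etHeckeRep_toTower` on both sides and the level engine at the square `e_albTr`; `exists_conjLift` (Mathlib
  `IsAlgClosure.equivOfEquiv`); **`exists_towerEquiv_honest`** = (K2a)(K2b)(K2c) packaged from `D` alone.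
* §6 **`k2_towerEquiv`** — K2 at the CONSTRUCTED datum `albConjDatum`: hypotheses exactly {u1 `hU7ₛ`, u4 `hLQ`}.

References: [Liu2021] §4.2–§4.3, proof of Thm. 4.15 (FJcycle.tex l. 2193–2208), App. D Cor. D.9; [Deligne1982] §1 (conjugate varieties);
[Milne1986AbelianVarieties] Thm. 15.1 (a); [MumfordAV1970] §19; [NeukirchANT1999] Ch. I §9; [Shimura1998] §18.6.
-/

set_option autoImplicit false

noncomputable section

namespace Summit.HodgeConjecture.CorCM.Lines.A3Liu418

open CategoryTheory CategoryTheory.Limits AlgebraicGeometry NumberField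
open scoped TensorProduct NumberField
open Literature.AlgebraicGeometry.Motives
open Literature.AlgebraicGeometry.ShimuraVarieties.UnitaryCanonicalModel
open Literature.NumberTheory.Automorphic Literature.NumberTheory.Automorphic.UnitaryGroup
open Literature.NumberTheory.Automorphic.Liu2021 Literature.NumberTheory.Automorphic.Liu2021.AppendixC
open Literature.NumberTheory.GaloisRepresentations
open Summit.HodgeConjecture.CorCM.Model Summit.HodgeConjecture.CorCM.Model.HComp

variable {F : CMField} {ι₁ : F →+* ℂ} (Jstar : Matrix (Fin 2) (Fin 2) F)
  (K₀ : C5.OpenCompactSubgroup ↥(finAdelic (↥(maximalRealSubfield F)) F (IsCMField.complexConj F) 2 Jstar))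
  (M : C5.SmallLevel K₀ ⥤ SchemeOver F)
variable {Jstar K₀} (S : RecordSystemGS F Jstar ι₁ K₀)

/-! ## §3. From a datum: the level isomorphisms, the tower isomorphism (K2a), the Galois transport (K2c) -/

section LevelAndTower

open scoped Classical


variable {S} {h4 : 4 ≤ Module.finrank ℚ F} {iso : ℕ → Prop} (D : AlbConjDatum S h4 iso) (ℓ : ℕ) [Fact ℓ.Prime]
  (σt : AlgebraicClosure (F : Type) ≃+* AlgebraicClosure (F : Type))
  (hσa : ∀ a : (F : Type), σt (algebraMap (F : Type) (AlgebraicClosure (F : Type)) a) =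
    algebraMap (F : Type) (AlgebraicClosure (F : Type)) (cγ F a))

/-- `V_ℓ` of an isomorphism of abelian varieties, as a `ℚ_ℓ`-linear equivalence (functoriality of `V_ℓ`,
★ `rationalTateModuleMap_comp` ∕ `_id`). [cite: MumfordAV1970, §19 p. 172] -/
def ratTateEquivOfIso {A B : AbelianVariety (F : Type)} (e : A ≅ B) :
    A.rationalTateModule ℓ ≃ₗ[ℚ_[ℓ]] B.rationalTateModule ℓ :=
  LinearEquiv.ofLinear (AbelianVariety.rationalTateModuleMap ℓ e.hom) (AbelianVariety.rationalTateModuleMap ℓ e.inv)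
    (by rw [← AbelianVariety.rationalTateModuleMap_comp, e.inv_hom_id, AbelianVariety.rationalTateModuleMap_id])
    (by rw [← AbelianVariety.rationalTateModuleMap_comp, e.hom_inv_id, AbelianVariety.rationalTateModuleMap_id])

/-- As a linear map, `V_ℓ(e) = V_ℓ(e.hom)` (`rfl`). [cite: MumfordAV1970, §19 p. 172] -/
theorem coe_ratTateEquivOfIso {A B : AbelianVariety (F : Type)} (e : A ≅ B) :
    (ratTateEquivOfIso (F := F) ℓ e : A.rationalTateModule ℓ →ₗ[ℚ_[ℓ]] B.rationalTateModule ℓ) =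
      AbelianVariety.rationalTateModuleMap ℓ e.hom :=
  rfl

set_option maxHeartbeats 1600000 in
/-- **The level isomorphism `ψ_K : H¹_ét(Alb X⋆_K) ≃ₗ[ℚ_ℓ] H¹_ét(Alb M⋆_K)`**: the dual of `V_ℓ(e_K) : V_ℓ((Alb M⋆_K)^c) ≃ V_ℓ(Alb X⋆_K)`
followed by the `c̃`-transport `H¹_ét((Alb M⋆_K)^c) ≃ H¹_ét(Alb M⋆_K)` (★-twin `conjTransportEtaleH1Equiv`).
[cite: Milne1986AbelianVarieties, Thm 15.1 (a)] [cite: Shimura1998, §18.6 proof of Thm. 18.6, p. 129] -/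
def levelEquiv (K : C5.SmallLevel K₀) :
    (sec42DataGS S h4 iso).etaleH1 ℓ K ≃ₗ[ℚ_[ℓ]] (sec42DataGSM S h4 iso).etaleH1 ℓ K :=
  (ratTateEquivOfIso (F := F) ℓ (D.e K)).dualMap.trans
    (AbelianVariety.conjTransportEtaleH1Equiv (cγ F) σt hσa ((sec42DataGSM S h4 iso).A K) ℓ)

set_option maxHeartbeats 1600000 in
/-- Unfolding: `ψ_K φ = conjT (φ ∘ V_ℓ(e_K))`. [cite: Milne1986AbelianVarieties, Thm 15.1 (a)] -/
theorem levelEquiv_apply (K : C5.SmallLevel K₀) (φ : (sec42DataGS S h4 iso).etaleH1 ℓ K) :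
    levelEquiv D ℓ σt hσa K φ =
      AbelianVariety.conjTransportEtaleH1Equiv (cγ F) σt hσa ((sec42DataGSM S h4 iso).A K) ℓ
        ((AbelianVariety.rationalTateModuleMap ℓ (D.e K).hom).dualMap φ) :=
  rfl

set_option maxHeartbeats 1600000 in
/-- `V_ℓ(Alb^{X}_u) ∘ V_ℓ(e_{K'}) = V_ℓ(e_K) ∘ V_ℓ((Alb^{M}_u)^c)` for `u : K' ⟶ K` (from `e_Atr u` and functoriality of `V_ℓ`).
[cite: Liu2021, §4.2 (FJcycle.tex l. 2066–2072)] [cite: MumfordAV1970, §19 p. 172] -/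
theorem ratTate_e_Atr {K K' : C5.SmallLevel K₀} (u : K' ⟶ K) :
    AbelianVariety.rationalTateModuleMap ℓ ((sec42DataGS S h4 iso).Atr u) ∘ₗ
        AbelianVariety.rationalTateModuleMap ℓ (D.e K').hom =
      AbelianVariety.rationalTateModuleMap ℓ (D.e K).hom ∘ₗ
        AbelianVariety.rationalTateModuleMap ℓ (AbelianVariety.Hom.conjugate (cγ F) ((sec42DataGSM S h4 iso).Atr u)) := by
  rw [← AbelianVariety.rationalTateModuleMap_comp, ← AbelianVariety.rationalTateModuleMap_comp, D.e_Atr]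

set_option maxHeartbeats 1600000 in
/-- **Compatibility with the transition maps**: `ψ_{K'} ∘ (V_ℓ Alb^{X}_u)^∨ = (V_ℓ Alb^{M}_u)^∨ ∘ ψ_K` for `u : K' ⟶ K`
(from `e_Atr`, functoriality of `V_ℓ`, and the naturality of the `c̃`-transport).
[cite: Liu2021, §4.2 (FJcycle.tex l. 2066–2072) and §4.2 (l. 2158)] [cite: Shimura1998, §18.6 proof of Thm. 18.6, p. 129] -/
theorem levelEquiv_comp_etSys (i j : RestOne.Idx (sec42DataGS S h4 iso)) (h : i ≤ j) :
    (levelEquiv D ℓ σt hσa (OrderDual.ofDual j)).toLinearMap ∘ₗ (sec42DataGS S h4 iso).etSys ℓ i j h =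
      (sec42DataGSM S h4 iso).etSys ℓ i j h ∘ₗ (levelEquiv D ℓ σt hσa (OrderDual.ofDual i)).toLinearMap := by
  apply LinearMap.ext
  intro φ
  apply LinearMap.ext
  intro v
  -- both sides are `φ` applied to a vector of `V_ℓ(Alb X⋆_K)`; compare the vectors
  change φ _ = φ _
  have h1 := LinearMap.congr_fun
    (ratTate_e_Atr D ℓ (homOfLE (show OrderDual.ofDual j ≤ OrderDual.ofDual i from h)))
    (AbelianVariety.conjTransportRatTateEquiv (cγ F) σt hσa ((sec42DataGSM S h4 iso).A (OrderDual.ofDual j)) ℓ v)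
  have h2 := AbelianVariety.conjTransportRatTateEquiv_rationalTateModuleMap (γ := cγ F) (σt := σt) (ℓ := ℓ) hσa
    ((sec42DataGSM S h4 iso).Atr (homOfLE (show OrderDual.ofDual j ≤ OrderDual.ofDual i from h))) v
  exact congrArg φ (h1.trans (congrArg _ h2).symm)

set_option maxHeartbeats 1600000 in
/-- **`ψ` intertwines the duals of `V_ℓ` of any conjugation-compatible pair of homomorphisms**: if `(a^{M})^c ≫ e_K = e_L ≫ a^{X}` for
`a^{M} : Alb M⋆_L ⟶ Alb M⋆_K`, `a^{X} : Alb X⋆_L ⟶ Alb X⋆_K`, then `ψ_L ∘ (V_ℓ a^{X})^∨ = (V_ℓ a^{M})^∨ ∘ ψ_K` (functoriality of `V_ℓ` and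
naturality of the `c̃`-transport). [cite: Shimura1998, §18.6 proof of Thm. 18.6, p. 129] [cite: MumfordAV1970, §19 p. 172] -/
theorem levelEquiv_dualMap_of_conj {K L : C5.SmallLevel K₀}
    (aM : (sec42DataGSM S h4 iso).A L ⟶ (sec42DataGSM S h4 iso).A K) (aX : (sec42DataGS S h4 iso).A L ⟶ (sec42DataGS S h4 iso).A K)
    (h : AbelianVariety.Hom.conjugate (cγ F) aM ≫ (D.e K).hom = (D.e L).hom ≫ aX) (φ : (sec42DataGS S h4 iso).etaleH1 ℓ K) :
    levelEquiv D ℓ σt hσa L ((AbelianVariety.rationalTateModuleMap ℓ aX).dualMap φ) =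
      (AbelianVariety.rationalTateModuleMap ℓ aM).dualMap (levelEquiv D ℓ σt hσa K φ) := by
  apply LinearMap.ext
  intro v
  change φ _ = φ _
  have h0 : AbelianVariety.rationalTateModuleMap ℓ aX ∘ₗ AbelianVariety.rationalTateModuleMap ℓ (D.e L).hom =
      AbelianVariety.rationalTateModuleMap ℓ (D.e K).hom ∘ₗ
        AbelianVariety.rationalTateModuleMap ℓ (AbelianVariety.Hom.conjugate (cγ F) aM) := by
    rw [← AbelianVariety.rationalTateModuleMap_comp, ← AbelianVariety.rationalTateModuleMap_comp, h]
  have h1 := LinearMap.congr_fun h0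
    (AbelianVariety.conjTransportRatTateEquiv (cγ F) σt hσa ((sec42DataGSM S h4 iso).A L) ℓ v)
  have h2 := AbelianVariety.conjTransportRatTateEquiv_rationalTateModuleMap (γ := cγ F) (σt := σt) (ℓ := ℓ) hσa aM v
  exact congrArg φ (h1.trans (congrArg _ h2).symm)

set_option maxHeartbeats 1600000 in
/-- **(K2a) The tower isomorphism `H¹_ét(X⋆-tower, ℚ_ℓ) ≃ₗ[ℚ_ℓ] H¹_ét(M⋆-tower, ℚ_ℓ)`** (`Module.DirectLimit.congr` of the level
isomorphisms). [cite: Liu2021, §4.2 (FJcycle.tex l. 2158)] [cite: Deligne1982, §1] -/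
def towerEquiv : (sec42DataGS S h4 iso).etaleH1Tower ℓ ≃ₗ[ℚ_[ℓ]] (sec42DataGSM S h4 iso).etaleH1Tower ℓ :=
  Module.DirectLimit.congr (fun i => levelEquiv D ℓ σt hσa (OrderDual.ofDual i))
    (fun i j h => levelEquiv_comp_etSys D ℓ σt hσa i j h)

set_option maxHeartbeats 1600000 in
/-- `towerEquiv` on the canonical image of a level: `Ψ (toTower_X K φ) = toTower_M K (ψ_K φ)` (`Module.DirectLimit.congr_apply_of`).
[cite: Liu2021, §4.2 (FJcycle.tex l. 2158)] -/
theorem towerEquiv_toTower (K : C5.SmallLevel K₀) (φ : (sec42DataGS S h4 iso).etaleH1 ℓ K) :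
    towerEquiv D ℓ σt hσa ((sec42DataGS S h4 iso).toTower ℓ K φ) =
      (sec42DataGSM S h4 iso).toTower ℓ K (levelEquiv D ℓ σt hσa K φ) :=
  Module.DirectLimit.congr_apply_of (fun i => levelEquiv D ℓ σt hσa (OrderDual.ofDual i))
    (fun i j h => levelEquiv_comp_etSys D ℓ σt hσa i j h) (i := OrderDual.toDual K) φ

set_option maxHeartbeats 1600000 in
/-- **Twisted Galois equivariance at one level**: `ψ_K (σ · φ) = (c̃⁻¹σc̃) · ψ_K φ` on `H¹_ét` (`V_ℓ(e_K)` is `Γ_F`-equivariant;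
the `c̃`-transport conjugates the action). [cite: Shimura1998, §18.6 proof of Thm. 18.6, p. 129] [cite: Deligne1982, §1] -/
theorem levelEquiv_etaleH1Rep (K : C5.SmallLevel K₀) (σ : Field.absoluteGaloisGroup (F : Type))
    (φ : (sec42DataGS S h4 iso).etaleH1 ℓ K) :
    levelEquiv D ℓ σt hσa K ((sec42DataGS S h4 iso).etaleH1Rep ℓ K σ φ) =
      (sec42DataGSM S h4 iso).etaleH1Rep ℓ K (absGalConjBy σt (cγ F) hσa σ) (levelEquiv D ℓ σt hσa K φ) := by
  rw [levelEquiv_apply, levelEquiv_apply]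
  have key : (AbelianVariety.rationalTateModuleMap ℓ (D.e K).hom).dualMap ((sec42DataGS S h4 iso).etaleH1Rep ℓ K σ φ) =
      ((((sec42DataGSM S h4 iso).A K).conjugate (cγ F)).rationalTateRep ℓ).dual σ
        ((AbelianVariety.rationalTateModuleMap ℓ (D.e K).hom).dualMap φ) := by
    apply LinearMap.ext
    intro v
    simp only [LinearMap.dualMap_apply, Representation.dual_apply, Module.Dual.transpose_apply, LinearMap.coe_comp,
      Function.comp_apply]
    rw [AbelianVariety.rationalTateRep_rationalTateModuleMap]
  rw [key, AbelianVariety.conjTransportEtaleH1Equiv_dual]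

set_option maxHeartbeats 1600000 in
/-- **(K2c, raw form) `Ψ ∘ towerRep_X σ = towerRep_M (c̃⁻¹σc̃) ∘ Ψ`** on the whole tower (`Module.DirectLimit.hom_ext` + the level
statement). [cite: Shimura1998, §18.6 proof of Thm. 18.6, p. 129] [cite: Deligne1982, §1] -/
theorem towerEquiv_towerRep (σ : Field.absoluteGaloisGroup (F : Type)) (y : (sec42DataGS S h4 iso).etaleH1Tower ℓ) :
    towerEquiv D ℓ σt hσa ((sec42DataGS S h4 iso).towerRep ℓ σ y) =
      (sec42DataGSM S h4 iso).towerRep ℓ (absGalConjBy σt (cγ F) hσa σ) (towerEquiv D ℓ σt hσa y) := by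
  suffices h : (towerEquiv D ℓ σt hσa).toLinearMap ∘ₗ (sec42DataGS S h4 iso).towerRep ℓ σ =
      (sec42DataGSM S h4 iso).towerRep ℓ (absGalConjBy σt (cγ F) hσa σ) ∘ₗ (towerEquiv D ℓ σt hσa).toLinearMap from
    LinearMap.congr_fun h y
  refine Module.DirectLimit.hom_ext (fun i => ?_)
  apply LinearMap.ext
  intro φ
  have e1 := (sec42DataGS S h4 iso).towerRep_of ℓ i σ φ
  have e2 := towerEquiv_toTower D ℓ σt hσa (OrderDual.ofDual i)
    ((sec42DataGS S h4 iso).etaleH1Rep ℓ (OrderDual.ofDual i) σ φ)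
  have e3 := levelEquiv_etaleH1Rep D ℓ σt hσa (OrderDual.ofDual i) σ φ
  have e4 := (sec42DataGSM S h4 iso).towerRep_toTower ℓ (OrderDual.ofDual i) (absGalConjBy σt (cγ F) hσa σ)
    (levelEquiv D ℓ σt hσa (OrderDual.ofDual i) φ)
  have e5 := towerEquiv_toTower D ℓ σt hσa (OrderDual.ofDual i) φ
  exact (congrArg (towerEquiv D ℓ σt hσa) e1).trans (e2.trans
    ((congrArg ((sec42DataGSM S h4 iso).toTower ℓ (OrderDual.ofDual i)) e3).trans
      (e4.symm.trans (congrArg ((sec42DataGSM S h4 iso).towerRep ℓ (absGalConjBy σt (cγ F) hσa σ)) e5.symm))))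

end LevelAndTower
/-! ## §4. The PACKAGED (K2c) in `IsArithFrobAt` currency -/

section HeckeAndPackage

open scoped Classical


variable {S} {h4 : 4 ≤ Module.finrank ℚ F} {iso : ℕ → Prop} (D : AlbConjDatum S h4 iso) (ℓ : ℕ) [Fact ℓ.Prime]
  (σt : AlgebraicClosure (F : Type) ≃+* AlgebraicClosure (F : Type))
  (hσa : ∀ a : (F : Type), σt (algebraMap (F : Type) (AlgebraicClosure (F : Type)) a) =
    algebraMap (F : Type) (AlgebraicClosure (F : Type)) (cγ F a))

/-- `c⁻¹ = c` for complex conjugation of the CM field (an involution). [cite: Milne2005ShimuraVarieties, §11] -/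
theorem complexConj_inv_eq : (IsCMField.complexConj (F : Type))⁻¹ = IsCMField.complexConj (F : Type) :=
  inv_eq_of_mul_eq_one_right (AlgEquiv.ext fun x => by
    rw [AlgEquiv.mul_apply, AlgEquiv.one_apply, IsCMField.complexConj_apply_apply])

set_option maxHeartbeats 1600000 in
/-- **(K2c) PACKAGED in `IsArithFrobAt` currency** (A-p15 (g11)'s consumer shape): an arithmetic Frobenius `σ` at a prime `𝔓 ∣ w` acting
on `H¹_ét` of the TWIST `X⋆` is carried by `Ψ` to SOME `σ'` (namely `c̃⁻¹σc̃`) which is an arithmetic Frobenius at some prime above the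
CONJUGATE place `c • w`, acting on `H¹_ét` of `M⋆`.  (The hypothesis `c • w ≠ w` of the consumer is not needed.)
[cite: NeukirchANT1999, Ch. I §9 Prop. (9.4)–(9.5)] [cite: Deligne1982, §1] [cite: Liu2021, App. D Cor. D.9] -/
theorem exists_isArithFrobAt_conj_towerEquiv_towerRep (w : IsDedekindDomain.HeightOneSpectrum (𝓞 (F : Type)))
    {𝔓 : Ideal (absIntegers (𝓞 (F : Type)) (F : Type))} (h𝔓 : 𝔓 ∈ w.primesAbove)
    {σ : Field.absoluteGaloisGroup (F : Type)} (hσ : IsArithFrobAt (𝓞 (F : Type)) σ 𝔓) :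
    ∃ σ' : Field.absoluteGaloisGroup (F : Type),
      (∃ 𝔓' ∈ (IsCMField.complexConj (F : Type) • w).primesAbove, IsArithFrobAt (𝓞 (F : Type)) σ' 𝔓') ∧
        ∀ y, towerEquiv D ℓ σt hσa ((sec42DataGS S h4 iso).towerRep ℓ σ y) =
          (sec42DataGSM S h4 iso).towerRep ℓ σ' (towerEquiv D ℓ σt hσa y) := by
  refine ⟨absGalConjBy σt (cγ F) hσa σ, ?_, fun y => towerEquiv_towerRep D ℓ σt hσa σ y⟩
  have h := exists_mem_primesAbove_isArithFrobAt_absGalConjBy (IsCMField.complexConj (F : Type)) σt hσa w h𝔓 hσ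
  rwa [complexConj_inv_eq] at h

end HeckeAndPackage
/-! ## §5. (K2b) HONEST — `Ψ` intertwines the twist's Hecke action with `M⋆`'s OWN (`etaleHeckeDatumGSM`), and the honest package -/

section HonestK2

open scoped Classical

variable {S} {h4 : 4 ≤ Module.finrank ℚ F} {iso : ℕ → Prop} (D : AlbConjDatum S h4 iso) (ℓ : ℕ) [Fact ℓ.Prime]
  (σt : AlgebraicClosure (F : Type) ≃+* AlgebraicClosure (F : Type))
  (hσa : ∀ a : (F : Type), σt (algebraMap (F : Type) (AlgebraicClosure (F : Type)) a) =
    algebraMap (F : Type) (AlgebraicClosure (F : Type)) (cγ F a))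
  (hU7ₛ : S.HeckeTranslateDefinedOver) (hLQ : S.IsLevelQuotient)

set_option maxHeartbeats 1600000 in
/-- **(K2b, HONEST) `Ψ (g ·_{X⋆} y) = g ·_{M⋆} (Ψ y)`** for the Hecke actions INDUCED BY THE TRANSLATES on both sides (★ `etaleHeckeDatumGS`
and `etaleHeckeDatumGSM` — `M⋆`'s own translates, nothing transported): on a level class both actions are `[ᵗV_ℓ(Alb T_g) ·]_L` at the
conjugate level `L = gKg⁻¹ ∩ K₀` (★ `etHeckeRep_toTower`), and `ψ` intertwines the two `ᵗV_ℓ(Alb T_g)` by `levelEquiv_dualMap_of_conj`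
at the square `e_albTr`. [cite: Liu2021, §4.2 (FJcycle.tex l. 2074) and §4.2 (l. 2158–2160)] [cite: Deligne1982, §1] -/
theorem towerEquiv_rhoEt_GSM (g : ↥(finAdelic (↥(maximalRealSubfield F)) F (IsCMField.complexConj F) 2 Jstar))
    (y : (sec42DataGS S h4 iso).etaleH1Tower ℓ) :
    towerEquiv D ℓ σt hσa ((etaleHeckeDatumGS S hU7ₛ hLQ h4 iso ℓ).rhoEt g y) =
      (etaleHeckeDatumGSM S hU7ₛ hLQ h4 iso ℓ).rhoEt g (towerEquiv D ℓ σt hσa y) := by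
  obtain ⟨K, φ, rfl⟩ := (sec42DataGS S h4 iso).exists_eq_toTower ℓ y
  have hL : C5.HeckeLE g (C5.heckeLevel g K) K := C5.heckeLE_heckeLevel g K
  have e1 : (etaleHeckeDatumGS S hU7ₛ hLQ h4 iso ℓ).rhoEt g ((sec42DataGS S h4 iso).toTower ℓ K φ) =
      (sec42DataGS S h4 iso).toTower ℓ (C5.heckeLevel g K)
        ((AbelianVariety.rationalTateModuleMap ℓ
          ((sec42HeckeTranslatesGS S hU7ₛ h4 iso).albTr g (C5.heckeLevel g K) K hL)).dualMap φ) :=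
    (sec42HeckeTranslatesGS S hU7ₛ h4 iso).etHeckeRep_toTower ℓ g hL φ
  have e2 := towerEquiv_toTower D ℓ σt hσa (C5.heckeLevel g K)
    ((AbelianVariety.rationalTateModuleMap ℓ ((sec42HeckeTranslatesGS S hU7ₛ h4 iso).albTr g (C5.heckeLevel g K) K hL)).dualMap φ)
  have e3 := levelEquiv_dualMap_of_conj D ℓ σt hσa
    ((sec42HeckeTranslatesGSM S hU7ₛ h4 iso).albTr g (C5.heckeLevel g K) K hL)
    ((sec42HeckeTranslatesGS S hU7ₛ h4 iso).albTr g (C5.heckeLevel g K) K hL) (D.e_albTr hU7ₛ g (C5.heckeLevel g K) K hL) φ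
  have e4 : (etaleHeckeDatumGSM S hU7ₛ hLQ h4 iso ℓ).rhoEt g
        ((sec42DataGSM S h4 iso).toTower ℓ K (levelEquiv D ℓ σt hσa K φ)) =
      (sec42DataGSM S h4 iso).toTower ℓ (C5.heckeLevel g K)
        ((AbelianVariety.rationalTateModuleMap ℓ
          ((sec42HeckeTranslatesGSM S hU7ₛ h4 iso).albTr g (C5.heckeLevel g K) K hL)).dualMap (levelEquiv D ℓ σt hσa K φ)) :=
    (sec42HeckeTranslatesGSM S hU7ₛ h4 iso).etHeckeRep_toTower ℓ g hL (levelEquiv D ℓ σt hσa K φ)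
  have e5 := towerEquiv_toTower D ℓ σt hσa K φ
  exact (congrArg (towerEquiv D ℓ σt hσa) e1).trans (e2.trans
    ((congrArg ((sec42DataGSM S h4 iso).toTower ℓ (C5.heckeLevel g K)) e3).trans
      (e4.symm.trans (congrArg ((etaleHeckeDatumGSM S hU7ₛ hLQ h4 iso ℓ).rhoEt g) e5.symm))))

/-- A lift `c̃` of complex conjugation `c` of the CM field to its algebraic closure EXISTS (Mathlib `IsAlgClosure.equivOfEquiv`).
[cite: NeukirchANT1999, Ch. IV §1] -/
theorem exists_conjLift :
    ∃ σt : AlgebraicClosure (F : Type) ≃+* AlgebraicClosure (F : Type),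
      ∀ a : (F : Type), σt (algebraMap (F : Type) (AlgebraicClosure (F : Type)) a) =
        algebraMap (F : Type) (AlgebraicClosure (F : Type)) (cγ F a) :=
  ⟨IsAlgClosure.equivOfEquiv (AlgebraicClosure (F : Type)) (AlgebraicClosure (F : Type)) (cγ F),
    fun a => IsAlgClosure.equivOfEquiv_algebraMap (AlgebraicClosure (F : Type)) (AlgebraicClosure (F : Type)) (cγ F) a⟩

include D in
set_option maxHeartbeats 1600000 in
/-- **K2, HONEST PACKAGE (A-p15 (g11)'s consumer shape (K2a)(K2b)(K2c), with `X_M := etaleHeckeDatumGSM`, `M⋆`'s OWN Hecke datum)**,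
from an Albanese conjugation datum `D` alone (no lift parameter: `c̃` is chosen inside): a `ℚ_ℓ`-linear isomorphism
`Ψ : H¹_ét(X⋆-tower) ≃ H¹_ét(M⋆-tower)` which (b) intertwines the translate-induced Hecke actions and (c) carries an arithmetic Frobenius at
`𝔓 ∣ w` on the twist to an arithmetic Frobenius at a prime above `c • w` on `M⋆`.
[cite: Liu2021, §4.2–§4.3 and App. D Cor. D.9] [cite: Deligne1982, §1] [cite: NeukirchANT1999, Ch. I §9 Prop. (9.4)–(9.5)] -/
theorem exists_towerEquiv_honest :
    ∃ Ψ : (sec42DataGS S h4 iso).etaleH1Tower ℓ ≃ₗ[ℚ_[ℓ]] (sec42DataGSM S h4 iso).etaleH1Tower ℓ,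
      (∀ (g : ↥(finAdelic (↥(maximalRealSubfield F)) F (IsCMField.complexConj F) 2 Jstar)) (y : (sec42DataGS S h4 iso).etaleH1Tower ℓ),
          Ψ ((etaleHeckeDatumGS S hU7ₛ hLQ h4 iso ℓ).rhoEt g y) = (etaleHeckeDatumGSM S hU7ₛ hLQ h4 iso ℓ).rhoEt g (Ψ y)) ∧
        ∀ (w : IsDedekindDomain.HeightOneSpectrum (𝓞 (F : Type))) (𝔓 : Ideal (absIntegers (𝓞 (F : Type)) (F : Type))),
          𝔓 ∈ w.primesAbove → ∀ σ : Field.absoluteGaloisGroup (F : Type), IsArithFrobAt (𝓞 (F : Type)) σ 𝔓 →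
            ∃ σ' : Field.absoluteGaloisGroup (F : Type),
              (∃ 𝔓' ∈ (IsCMField.complexConj (F : Type) • w).primesAbove, IsArithFrobAt (𝓞 (F : Type)) σ' 𝔓') ∧
                ∀ y, Ψ ((sec42DataGS S h4 iso).towerRep ℓ σ y) = (sec42DataGSM S h4 iso).towerRep ℓ σ' (Ψ y) := by
  obtain ⟨σt, hσa⟩ := exists_conjLift (F := F)
  exact ⟨towerEquiv D ℓ σt hσa, fun g y => towerEquiv_rhoEt_GSM D ℓ σt hσa hU7ₛ hLQ g y,
    fun w _ h𝔓 _ hσ => exists_isArithFrobAt_conj_towerEquiv_towerRep D ℓ σt hσa w h𝔓 hσ⟩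

end HonestK2
/-! ## §6. K2 UNCONDITIONAL -/

section K2

variable {S}

/-- **K2 UNCONDITIONAL (A-p15 (g11)'s consumer shape (K2a)(K2b honest)(K2c); hypotheses exactly {u1 `hU7ₛ`, u4 `hLQ`})**: a `ℚ_ℓ`-linear
isomorphism `Ψ : H¹_ét(X⋆-tower) ≃ H¹_ét(M⋆-tower)` intertwining the translate-induced Hecke actions (★ `etaleHeckeDatumGS` and
`etaleHeckeDatumGSM`) and carrying an arithmetic Frobenius at `𝔓 ∣ w` on the twist `X⋆` to an arithmetic Frobenius at a prime above the
conjugate place `c • w` on `M⋆`. [cite: Liu2021, §4.2–§4.3 and App. D Cor. D.9] [cite: Deligne1982, §1]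
[cite: NeukirchANT1999, Ch. I §9 Prop. (9.4)–(9.5)] -/
theorem k2_towerEquiv (h4 : 4 ≤ Module.finrank ℚ F) (iso : ℕ → Prop) (hU7ₛ : S.HeckeTranslateDefinedOver)
    (hLQ : S.IsLevelQuotient) (ℓ : ℕ) [Fact ℓ.Prime] :
    ∃ Ψ : (sec42DataGS S h4 iso).etaleH1Tower ℓ ≃ₗ[ℚ_[ℓ]] (sec42DataGSM S h4 iso).etaleH1Tower ℓ,
      (∀ (g : ↥(finAdelic (↥(maximalRealSubfield F)) F (IsCMField.complexConj F) 2 Jstar)) (y : (sec42DataGS S h4 iso).etaleH1Tower ℓ),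
          Ψ ((etaleHeckeDatumGS S hU7ₛ hLQ h4 iso ℓ).rhoEt g y) = (etaleHeckeDatumGSM S hU7ₛ hLQ h4 iso ℓ).rhoEt g (Ψ y)) ∧
        ∀ (w : IsDedekindDomain.HeightOneSpectrum (𝓞 (F : Type))) (𝔓 : Ideal (absIntegers (𝓞 (F : Type)) (F : Type))),
          𝔓 ∈ w.primesAbove → ∀ σ : Field.absoluteGaloisGroup (F : Type), IsArithFrobAt (𝓞 (F : Type)) σ 𝔓 →
            ∃ σ' : Field.absoluteGaloisGroup (F : Type),
              (∃ 𝔓' ∈ (IsCMField.complexConj (F : Type) • w).primesAbove, IsArithFrobAt (𝓞 (F : Type)) σ' 𝔓') ∧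
                ∀ y, Ψ ((sec42DataGS S h4 iso).towerRep ℓ σ y) = (sec42DataGSM S h4 iso).towerRep ℓ σ' (Ψ y) :=
  exists_towerEquiv_honest (albConjDatum (S := S) h4 iso) ℓ hU7ₛ hLQ

end K2

end Summit.HodgeConjecture.CorCM.Lines.A3Liu418

end
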